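import Literature.Analysis.FluidPDE.SereginZhou2020
import Literature.Analysis.FluidPDE.LocalTypeI
import HarnessLib

/-!
# Seregin–Zhou 2020, Thm 1.2 as rendered with a genuine `sup_t` is false: a counterexample

Analysis/FluidPDE. The named fact
`Literature.Analysis.FluidPDE.SereginZhou2020.scaledEnergies_lt_top` (`SereginZhou2020.lean`,
[cite: SereginZhou2020, Thm 1.2]) renders "all scaled energies are bounded" with the tree's
`cknA`, whose supremum over the times `t ∈ (t₀ - r², t₀)` is a GENUINE `⨆` (`SuitableWeak.lean`,
design notes: "for a non-normalised representative of `u` this is slightly stronger than CKN's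
`A`"), whereas every hypothesis bundled in `SereginZhou2020.Hypotheses T v q G` sees the velocity
field `v` only through space–time integrals and `∀ᵐ t` statements (`IsSuitableWeakSolutionOn`:
integrals over the slab and an `∀ᵐ t` energy class; `HasWeakSpatialGradientOn`: local
integrability and iterated integrals; `FiniteEnergyClassUpTo`: `∀ᵐ t` and lower integrals; the
Besov bound (1.1): `∀ᵐ t`). Redefining a solution on a null set of times therefore keeps all
hypotheses and can destroy the conclusion. In the paper (`v ∈ L_∞(δ,T; L_{2,loc})`,
Def. 1.1 (i)) the supremum in `A(z₀,r)` is an essential supremum.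

This file proves, sorry-free and with theorems only, that the rendered statement is false
(`SereginZhou2020.not_scaledEnergies_lt_top`; written out in full, so that the refutation survives
a retirement of the def, as `SereginZhou2020.not_forall_hypotheses_cknA_lt_top`). Physical space
`ℝ³` is `EuclideanSpace ℝ (Fin 3)` throughout (written out; no local notation). Since the
verdict clean-up of `SereginZhou2020.lean` (2026-08-16) the refuted def is a `@[deprecated]`
tombstone kept verbatim only because `not_scaledEnergies_lt_top` names it; the deprecation linter
is therefore silenced on exactly that one declaration below (REMOVE-WHEN the def is deleted and
`not_scaledEnergies_lt_top` is restated over the written-out sentence).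

## The argument (`namespace SereginZhou2020.Counterexample`)

* **Blindness of the hypotheses** (`hypotheses_of_ae_eq_zero`): for ANY field
  `v : ℝ → ℝ³ → ℝ³` whose time slices vanish for a.e. `t` (`∀ᵐ t, v t = 0`), the tuple
  `(T, v, q, G) = (1, v, 0, 0)` satisfies `Hypotheses 1 v 0 0`: `uncurry v = 0` a.e. on
  `ℝ × ℝ³` (the exceptional set lies in `{t | v t ≠ 0} × ℝ³`, a null set), so `(v, 0)` is a
  distributional and suitable weak solution on every open region with weak gradient `0` (all
  integrands vanish a.e., the local energy inequality reads `0 ≤ 0`), lies in the energy class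
  of Def. 1.1 (i) up to `T = 1`, and satisfies the heat-flow Besov bound with `M = 0` at a.e.
  time (`e^{sΔ} 0 = 0`).
* **Sensitivity of the conclusion** (`cknA_eq_top_of_forall_exists`): if the slice energies
  `∫_{B(0,1/4)} |v(t)|²`, `t ∈ (15/16, 1)`, are unbounded, then `cknA (1/4) (1, 0) v = ⊤`.
* **The example** (proof of `not_scaledEnergies_lt_top`): `v t x = 𝟙_ℚ(t) · (1 - t)⁻¹ • e₀`,
  zero at irrational times (ℚ is Lebesgue-null), the constant field `(1-t)⁻¹ e₀` at rational
  times, whose slice energy `(1-t)⁻² |B(0,1/4)|` is unbounded as `ℚ ∋ t ↑ 1`; and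
  `1/4 ∈ (0, ½ min{1, 1})`, `t₀ = T = 1`, `x₀ = 0`.
* Sanity check of the correction: the essential-supremum quantity of the tree (`cknAEss`,
  `LocalTypeI.lean`, Albritton–Barker's `A`) vanishes for every field with a.e.-zero slices
  (`cknAEss_eq_zero_of_ae_eq_zero`). The corrected rendering of Thm 1.2 replaces `cknA` by
  `cknAEss`.

## References

* G. Seregin, D. Zhou, *Regularity of solutions to the Navier–Stokes equations in
  `Ḃ^{-1}_{∞,∞}`*, J. Math. Sci. 244 (2020) 1003–1009, arXiv:1802.03600: Def. 1.1 (i)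
  (`v ∈ L_∞(δ,T;L_{2,loc})`), the display defining `A(z₀,r)` (p. 2), Thm 1.2.
  [`SereginZhou2020`]
-/

noncomputable section

open MeasureTheory Set Metric Function Filter
open scoped ENNReal NNReal Topology InnerProductSpace RealInnerProductSpace Laplacian
open Literature.Analysis.UnboundedOperators

namespace Literature.Analysis.FluidPDE

namespace SereginZhou2020

namespace Counterexample

variable {v : ℝ → EuclideanSpace ℝ (Fin 3) → EuclideanSpace ℝ (Fin 3)}

/-! ### Fields with a.e.-vanishing time slices satisfy every hypothesis of Thm 1.2 -/

/-- If `v(t) = 0` for a.e. `t`, then `v` vanishes a.e. on space–time (the exceptional set lies in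
the null set `{t | v t ≠ 0} × ℝ³`). [folklore] -/
theorem uncurry_ae_eq_zero (hv : ∀ᵐ t : ℝ, v t = 0) :
    uncurry v =ᵐ[volume] (0 : ℝ × EuclideanSpace ℝ (Fin 3) → EuclideanSpace ℝ (Fin 3)) := by
  have h0 : volume ({t : ℝ | ¬v t = 0} ×ˢ (univ : Set (EuclideanSpace ℝ (Fin 3)))) = 0 := by
    rw [Measure.volume_eq_prod, Measure.prod_prod, ae_iff.1 hv, zero_mul]
  rw [EventuallyEq, ae_iff]
  refine measure_mono_null (fun z hz => ?_) h0
  refine mem_prod.2 ⟨?_, mem_univ _⟩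
  intro ht
  exact hz (show v z.1 z.2 = 0 by rw [ht]; rfl)

/-- A field with a.e.-zero slices is integrable on space–time. [folklore] -/
theorem integrable_uncurry (hv : ∀ᵐ t : ℝ, v t = 0) : Integrable (uncurry v) volume :=
  (integrable_zero _ _ _).congr (uncurry_ae_eq_zero hv).symm

/-- A field with a.e.-zero slices has `|v|²` integrable on space–time. [folklore] -/
theorem integrable_norm_sq (hv : ∀ᵐ t : ℝ, v t = 0) :
    Integrable (fun z : ℝ × EuclideanSpace ℝ (Fin 3) => ‖uncurry v z‖ ^ 2) volume :=
  (integrable_zero _ _ _).congr ((uncurry_ae_eq_zero hv).mono fun z hz => by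
    have hz' : uncurry v z = 0 := hz
    change (0 : ℝ) = ‖uncurry v z‖ ^ 2
    rw [hz', norm_zero, zero_pow two_ne_zero])

/-- `0` is a weak spatial gradient of a field with a.e.-zero slices, on any open region.
[folklore] -/
theorem hasWeakSpatialGradientOn_zero_of_ae_eq_zero (hv : ∀ᵐ t : ℝ, v t = 0)
    (Q : TopologicalSpace.Opens (ℝ × EuclideanSpace ℝ (Fin 3))) :
    HasWeakSpatialGradientOn Q v
      (0 : ℝ → EuclideanSpace ℝ (Fin 3) → EuclideanSpace ℝ (Fin 3) →L[ℝ] EuclideanSpace ℝ (Fin 3))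
    where
  locallyIntegrableOn := (integrable_uncurry hv).locallyIntegrable.locallyIntegrableOn _
  locallyIntegrableOn_grad :=
    (integrable_zero (ℝ × EuclideanSpace ℝ (Fin 3))
      (EuclideanSpace ℝ (Fin 3) →L[ℝ] EuclideanSpace ℝ (Fin 3))
        volume).locallyIntegrable.locallyIntegrableOn _
  integral_fderiv_mul_inner_eq φ _ v' w := by
    have hL : (fun t => ∫ x, fderiv ℝ (φ t) x v' * ⟪v t x, w⟫) =ᵐ[volume] (0 : ℝ → ℝ) :=
      hv.mono fun t ht => by simp [ht]
    rw [integral_eq_zero_of_ae hL]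
    simp

/-- `(v, 0)` with a.e.-zero slices solves Navier–Stokes (`ν = 1`, `f = 0`) in the sense of
distributions on any open region: every integrand vanishes a.e. [folklore] -/
theorem isDistributionalNSSolutionOn_of_ae_eq_zero (hv : ∀ᵐ t : ℝ, v t = 0)
    (Q : TopologicalSpace.Opens (ℝ × EuclideanSpace ℝ (Fin 3))) :
    IsDistributionalNSSolutionOn Q 1 0 v 0 := by
  refine ⟨(integrable_uncurry hv).locallyIntegrable.locallyIntegrableOn _,
    (integrable_norm_sq hv).locallyIntegrable.locallyIntegrableOn _,
    (integrable_zero (ℝ × EuclideanSpace ℝ (Fin 3)) ℝ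
      volume).locallyIntegrable.locallyIntegrableOn _,
    fun θ _ => ?_, fun ψ _ => ?_⟩
  · refine integral_eq_zero_of_ae (ae_restrict_of_ae ((uncurry_ae_eq_zero hv).mono fun z hz => ?_))
    have hz' : v z.1 z.2 = 0 := hz
    simp [hz']
  · refine integral_eq_zero_of_ae (ae_restrict_of_ae ((uncurry_ae_eq_zero hv).mono fun z hz => ?_))
    have hz' : v z.1 z.2 = 0 := hz
    simp [hz']

/-- `(v, 0)` with a.e.-zero slices is a suitable weak solution (`ν = 1`, `f = 0`) on any open
region, with weak gradient `0`; the local energy inequality reads `0 ≤ 0`. [folklore] -/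
theorem isSuitableWeakSolutionOn_of_ae_eq_zero (hv : ∀ᵐ t : ℝ, v t = 0)
    (Q : TopologicalSpace.Opens (ℝ × EuclideanSpace ℝ (Fin 3))) :
    IsSuitableWeakSolutionOn Q 1 0 v 0 := by
  refine ⟨isDistributionalNSSolutionOn_of_ae_eq_zero hv Q, fun K _ _ => ⟨0, ?_⟩,
    fun K _ _ => ?_,
    ⟨0, hasWeakSpatialGradientOn_zero_of_ae_eq_zero hv Q, fun K _ _ => ?_, fun φ _ _ => ?_⟩⟩
  · filter_upwards [hv] with t ht
    have : (fun x : EuclideanSpace ℝ (Fin 3) =>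
        K.indicator (fun z : ℝ × EuclideanSpace ℝ (Fin 3) => ‖v z.1 z.2‖ₑ ^ 2) (t, x)) =
        fun _ => 0 := by
      funext x
      by_cases hK : (t, x) ∈ K
      · rw [indicator_of_mem hK]
        simp [ht]
      · rw [indicator_of_notMem hK]
    rw [this, lintegral_zero]
    exact zero_le
  · simp only [Pi.zero_apply, enorm_zero]
    rw [ENNReal.zero_rpow_of_pos (by norm_num)]
    simp
  · simp [frobeniusNormSq_zero]
  · have hR : (fun t => ∫ x, (‖v t x‖ ^ 2 * (timeDeriv φ t x + 1 * Δ (φ t) x) +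
        (‖v t x‖ ^ 2 + 2 * (0 : ℝ → EuclideanSpace ℝ (Fin 3) → ℝ) t x) *
          ⟪v t x, gradient (φ t) x⟫ +
        2 * ⟪(0 : ℝ → EuclideanSpace ℝ (Fin 3) → EuclideanSpace ℝ (Fin 3)) t x, v t x⟫ *
          φ t x)) =ᵐ[volume] (0 : ℝ → ℝ) :=
      hv.mono fun t ht => by simp [ht]
    rw [integral_eq_zero_of_ae hR]
    simp

/-- The energy class of Def. 1.1 (i) up to `T = 1` holds trivially for a.e.-zero slices
(`G = 0`, `q = 0`). [folklore] -/
theorem finiteEnergyClassUpTo_of_ae_eq_zero (hv : ∀ᵐ t : ℝ, v t = 0) :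
    FiniteEnergyClassUpTo 1 v 0 0 := by
  intro _ _ _ _ _ _
  refine ⟨⟨0, ?_⟩, ?_, ?_⟩
  · filter_upwards [hv] with t ht _
    simp [ht]
  · simp [frobeniusNormSq_zero]
  · simp only [Pi.zero_apply, enorm_zero]
    rw [ENNReal.zero_rpow_of_pos (by norm_num)]
    simp

/-- The zero field satisfies the heat-flow Besov bound with `M = 0` (`e^{sΔ} 0 = 0`).
[folklore] -/
theorem heatBesovBound_zero :
    HeatBesovBound 0 (0 : EuclideanSpace ℝ (Fin 3) → EuclideanSpace ℝ (Fin 3)) := fun s _ x => by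
  refine ⟨?_, ?_⟩
  · simp only [Pi.zero_apply, smul_zero]
    exact integrable_zero _ _ _
  · have : heatExtension (0 : EuclideanSpace ℝ (Fin 3) → EuclideanSpace ℝ (Fin 3)) s = 0 := by
      rw [heatExtension]
      exact convolution_zero
    simp [this]

/-- **Blindness of the hypotheses to null sets of times.** Every field whose time slices vanish
for a.e. `t` satisfies, with `q = 0`, `G = 0`, `T = 1`, all standing hypotheses of Thm 1.2 as
rendered. [folklore] -/
theorem hypotheses_of_ae_eq_zero (hv : ∀ᵐ t : ℝ, v t = 0) : Hypotheses 1 v 0 0 where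
  pos := one_pos
  suitable := isSuitableWeakSolutionOn_of_ae_eq_zero hv _
  weakGradient := hasWeakSpatialGradientOn_zero_of_ae_eq_zero hv _
  energyClass := finiteEnergyClassUpTo_of_ae_eq_zero hv
  besov := ⟨0, hv.mono fun t ht _ => by rw [ht]; exact heatBesovBound_zero⟩

/-- Sanity check for the correction: the ESSENTIAL-supremum scaled energy of the tree
(`cknAEss`, Albritton–Barker's `A`) vanishes for every field with a.e.-zero slices. [folklore] -/
theorem cknAEss_eq_zero_of_ae_eq_zero (hv : ∀ᵐ t : ℝ, v t = 0) (r : ℝ)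
    (z : ℝ × EuclideanSpace ℝ (Fin 3)) : cknAEss r z v = 0 := by
  refine le_antisymm (essSup_le_of_ae_le 0 (ae_restrict_of_ae ?_)) zero_le
  filter_upwards [hv] with t ht
  simp [ht]

/-! ### The genuine-supremum quantity `A` sees every single time slice -/

/-- **Sensitivity of the conclusion.** If the slice energies `∫_{B(0,1/4)} |v(t)|²` are unbounded
along times `t ∈ (15/16, 1) = (1 - (1/4)², 1)`, then `cknA (1/4) (1, 0) v = ⊤`. [folklore] -/
theorem cknA_eq_top_of_forall_exists
    (h : ∀ n : ℕ, ∃ t ∈ Ioo (15 / 16 : ℝ) 1,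
      (n : ℝ≥0∞) ≤ ∫⁻ x in ball (0 : EuclideanSpace ℝ (Fin 3)) (1 / 4), ‖v t x‖ₑ ^ 2) :
    cknA (1 / 4 : ℝ) ((1 : ℝ), (0 : EuclideanSpace ℝ (Fin 3))) v = ∞ := by
  by_contra hne
  obtain ⟨n, hn⟩ := ENNReal.exists_nat_gt hne
  obtain ⟨t, ht, hnt⟩ := h n
  set z₀ : ℝ × EuclideanSpace ℝ (Fin 3) := ((1 : ℝ), (0 : EuclideanSpace ℝ (Fin 3))) with hz₀
  have hmem : t ∈ Ioo (z₀.1 - (1 / 4 : ℝ) ^ 2) z₀.1 := by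
    simp only [hz₀, mem_Ioo] at ht ⊢
    constructor <;> norm_num <;> linarith [ht.1, ht.2]
  have hle : (ENNReal.ofReal (1 / 4 : ℝ))⁻¹ * ∫⁻ x in ball z₀.2 (1 / 4), ‖v t x‖ₑ ^ 2 ≤
      cknA (1 / 4 : ℝ) z₀ v :=
    le_iSup₂ (f := fun s (_ : s ∈ Ioo (z₀.1 - (1 / 4 : ℝ) ^ 2) z₀.1) =>
      (ENNReal.ofReal (1 / 4 : ℝ))⁻¹ * ∫⁻ x in ball z₀.2 (1 / 4), ‖v s x‖ₑ ^ 2) t hmem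
  have hone : (1 : ℝ≥0∞) ≤ (ENNReal.ofReal (1 / 4 : ℝ))⁻¹ := by
    rw [ENNReal.one_le_inv, ENNReal.ofReal_le_one]
    norm_num
  exact lt_irrefl _ (hn.trans_le (hnt.trans ((le_mul_of_one_le_left zero_le hone).trans hle)))

end Counterexample

/-! ### The refutation -/

-- `scaledEnergies_lt_top` is `@[deprecated]` (refuted here; verdict clean-up 2026-08-16) and its
-- refutation must name it; REMOVE-WHEN the deprecated def is deleted from `SereginZhou2020.lean`.
set_option linter.deprecated false in
open Counterexample in
/-- **`scaledEnergies_lt_top` is false as rendered** (genuine `sup_t` in `cknA` versus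
a.e.-in-time hypotheses): the tuple `(T, v, q, G) = (1, 𝟙_ℚ(t)(1-t)⁻¹e₀, 0, 0)` satisfies
`Hypotheses` (its slices vanish at every irrational time) while `A((1,0), 1/4) = ⊤` (at rational
times `t ↑ 1` the slice energy is `(1-t)⁻² |B(0,1/4)| → ∞`) and `1/4 ∈ (0, ½ min{1, 1})`. The
paper's `A(z₀,r)` is an essential supremum (`v ∈ L_∞(δ,T;L_{2,loc})`, Def. 1.1 (i)); the
corrected rendering uses `cknAEss`. [cite: SereginZhou2020, Def. 1.1 (i) and Thm 1.2] -/
theorem not_scaledEnergies_lt_top : ¬ scaledEnergies_lt_top := by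
  intro h
  -- the data
  set e : EuclideanSpace ℝ (Fin 3) := EuclideanSpace.single 0 1 with he_def
  have he : ‖e‖ₑ = 1 := by
    rw [← ofReal_norm]
    simp [e]
  set S : Set ℝ := range ((↑) : ℚ → ℝ) with hS_def
  have hS : volume S = 0 := (countable_range _).measure_zero volume
  set v : ℝ → EuclideanSpace ℝ (Fin 3) → EuclideanSpace ℝ (Fin 3) :=
    fun t _ => S.indicator (fun s : ℝ => (1 - s)⁻¹ • e) t with hv_def
  -- a.e. slice vanishes
  have hv : ∀ᵐ t : ℝ, v t = 0 := by
    have h' : ∀ᵐ t : ℝ, t ∉ S := measure_eq_zero_iff_ae_notMem.1 hS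
    exact h'.mono fun t ht => funext fun x => indicator_of_notMem ht _
  -- unbounded slice energies along rational times `t ↑ 1`
  have hP : ∀ n : ℕ, ∃ t ∈ Ioo (15 / 16 : ℝ) 1,
      (n : ℝ≥0∞) ≤ ∫⁻ x in ball (0 : EuclideanSpace ℝ (Fin 3)) (1 / 4), ‖v t x‖ₑ ^ 2 := by
    intro n
    set V : ℝ≥0∞ := volume (ball (0 : EuclideanSpace ℝ (Fin 3)) (1 / 4)) with hV
    have hV0 : V ≠ 0 :=
      (measure_ball_pos volume (0 : EuclideanSpace ℝ (Fin 3)) (by norm_num : (0 : ℝ) < 1 / 4)).ne'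
    have hVtop : V ≠ ∞ := measure_ball_lt_top.ne
    set B : ℝ := ((n : ℝ≥0∞) / V).toReal with hB
    have hB0 : 0 ≤ B := ENNReal.toReal_nonneg
    have hlt : max (15 / 16 : ℝ) (1 - 1 / (B + 1)) < 1 := by
      refine max_lt (by norm_num) ?_
      have : 0 < 1 / (B + 1) := by positivity
      linarith
    obtain ⟨q, hq1, hq2⟩ := exists_rat_btwn hlt
    have hqS : (q : ℝ) ∈ S := mem_range_self q
    have hq15 : (15 / 16 : ℝ) < q := lt_of_le_of_lt (le_max_left _ _) hq1
    have hqB : 1 - 1 / (B + 1) < q := lt_of_le_of_lt (le_max_right _ _) hq1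
    have hq1' : (q : ℝ) < 1 := by exact_mod_cast hq2
    have h1q : 0 < 1 - (q : ℝ) := by linarith
    -- `B + 1 ≤ (1 - q)⁻¹`, hence `B ≤ ((1 - q)⁻¹)²`
    have hinv : B + 1 ≤ (1 - (q : ℝ))⁻¹ := by
      rw [le_inv_comm₀ (by positivity) h1q, inv_eq_one_div]
      linarith
    have hsq : B ≤ ((1 - (q : ℝ))⁻¹) ^ 2 := by nlinarith
    refine ⟨q, ⟨hq15, hq1'⟩, ?_⟩
    have hvq : ∀ x : EuclideanSpace ℝ (Fin 3), v q x = (1 - (q : ℝ))⁻¹ • e :=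
      fun x => indicator_of_mem hqS _
    simp only [hvq]
    rw [setLIntegral_const, enorm_smul, he, mul_one, Real.enorm_eq_ofReal (inv_nonneg.2 h1q.le),
      ← ENNReal.ofReal_pow (inv_nonneg.2 h1q.le)]
    calc (n : ℝ≥0∞) = (n : ℝ≥0∞) / V * V := (ENNReal.div_mul_cancel hV0 hVtop).symm
      _ = ENNReal.ofReal B * V := by
        rw [hB, ENNReal.ofReal_toReal (ENNReal.div_lt_top (ENNReal.natCast_ne_top n) hV0).ne]
      _ ≤ ENNReal.ofReal (((1 - (q : ℝ))⁻¹) ^ 2) * V :=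
        mul_le_mul_left (ENNReal.ofReal_le_ofReal hsq) V
  -- conclusion of the rendered fact at `t₀ = T = 1`, `x₀ = 0`, versus `A(1/4) = ⊤`
  have hA := (h 1 v 0 0 (hypotheses_of_ae_eq_zero hv) 1 ⟨one_pos, le_rfl⟩ 0).1
  have hr : (1 / 4 : ℝ) ∈ Ioo 0 (min 1 (1 : ℝ) / 2) := by norm_num
  have hle : cknA (1 / 4 : ℝ) ((1 : ℝ), (0 : EuclideanSpace ℝ (Fin 3))) v ≤
      ⨆ r ∈ Ioo 0 (min 1 (1 : ℝ) / 2), cknA r ((1 : ℝ), (0 : EuclideanSpace ℝ (Fin 3))) v :=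
    le_iSup₂ (f := fun r (_ : r ∈ Ioo 0 (min 1 (1 : ℝ) / 2)) =>
      cknA r ((1 : ℝ), (0 : EuclideanSpace ℝ (Fin 3))) v) (1 / 4 : ℝ) hr
  rw [cknA_eq_top_of_forall_exists hP, top_le_iff] at hle
  exact hA.ne hle

/-- The refuted statement written out in full (independent of the def `scaledEnergies_lt_top`):
it is NOT the case that every `(T, v, q, G)` satisfying `Hypotheses T v q G` has
`⨆_{0<r<½min{1,t₀}} cknA r (t₀,x₀) v < ∞` (with `cknE`, `cknC`) at every `t₀ ∈ (0,T]`, `x₀`.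
[cite: SereginZhou2020, Def. 1.1 (i) and Thm 1.2] -/
theorem not_forall_hypotheses_cknA_lt_top :
    ¬ ∀ (T : ℝ) (v : ℝ → EuclideanSpace ℝ (Fin 3) → EuclideanSpace ℝ (Fin 3))
        (q : ℝ → EuclideanSpace ℝ (Fin 3) → ℝ)
        (G : ℝ → EuclideanSpace ℝ (Fin 3) →
          EuclideanSpace ℝ (Fin 3) →L[ℝ] EuclideanSpace ℝ (Fin 3)),
      Hypotheses T v q G → ∀ t₀ ∈ Ioc 0 T, ∀ x₀ : EuclideanSpace ℝ (Fin 3),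
        (⨆ r ∈ Ioo 0 (min 1 t₀ / 2), cknA r (t₀, x₀) v) < ∞ ∧
        (⨆ r ∈ Ioo 0 (min 1 t₀ / 2), cknE r (t₀, x₀) G) < ∞ ∧
        (⨆ r ∈ Ioo 0 (min 1 t₀ / 2), cknC r (t₀, x₀) v) < ∞ :=
  not_scaledEnergies_lt_top

end SereginZhou2020

end Literature.Analysis.FluidPDE

end
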